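import Mathlib
import HarnessLib
import Literature.Analysis.FluidPDE.VorticityCalculus
import Summits.NavierStokesRegularity.NavierStokesRegularity.Theorems.PoloidalWindowDoorPoloidalWindowRigidityWindow
import Summits.NavierStokesRegularity.NavierStokesRegularity.Theorems.PoloidalWindowDoorPoloidalWindowRigidityFirstIntegral
import Summits.NavierStokesRegularity.NavierStokesRegularity.Theorems.PoloidalWindowDoorPoloidalWindowRigidityLoopTangencyPin
import Summits.NavierStokesRegularity.NavierStokesRegularity.Theorems.PoloidalWindowDoorPoloidalWindowRigidityDiscDichotomy

/-!
# Route `PoloidalWindowDoor`, crux `PoloidalWindowRigidity` (stmt-NavierStokesRegularity-19708) — LINE 15 «hot_split» v1.4.1 (ns-idea-8 g8; critic idea-crit-7 C2a SIZING,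
# KEY-NS #182 (2)): the M-sized INTERIOR of the ridge cells in the tree — R1 `HotSetClosedCritical`, R2 `VortexLineHot`, R3 `NoCompactIsolatedHotPiece`,
# R4 `HotSetNoInterior` (part 1; part 2 `…HotSplitRidgeKernels`: R5 `HotComponentUnbounded` and the kernels «C2a ⇐ C2a′», «C2b ⇐ C2b′»)

Cell ns-regularity-ideate, seat ns-poloidal-K2-p2 g13 (K2 hand).  Port to Theorems level of `section RProofs` + the two bookkeeping kernels of the line file
`Cruxes/PoloidalWindowRigidity/Lines/hot_split.lean` v1.5 (sorry-free there; ns-idea-8 g8), statements VERBATIM with the Cruxes-local `Pinned C v`, `ThickWindow v W`,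
`Peakless v` and `hotSet v = {y | y 2 = 0 ∧ v (-1) y 2 = v (-1) 0 2}` unfolded (same convention as A1 p677063 / C1 p686737), proof scripts verbatim over the tree tools
`…Window.isTypeIAncientMild_of_class`, `…LoopTangencyPin.fderiv_eq_zero_of_abs_le` / `apply_integralCurve_eq`, `…DiscDichotomy.eq_const_on_plane_of_analytic`, Mathlib
Picard–Lindelöf.  With these, hot_split's ridge cells C2a / C2b (`stub_cellC2a` / `stub_cellC2b`) are EQUIVALENT to their typed residues C2a′ / C2b′ in the tree
(`cellC2a_of_ridge`, `cellC2b_of_ridge`); the residues themselves are OPEN research (CENSUS-C2-g8: no lever known).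

WHAT THIS IS NOT: no mathematics toward C2a′ / C2b′; the THICK column's residue stays C2a′ ∧ C2b′ ∧ S0 ∧ ⟨27893⟩; 19708 / 20428 OPEN; no claim about Navier–Stokes regularity.
-/

noncomputable section

-- the summit and its single sub-problem share the name (CONVENTIONS §1), as in every Theorems file
set_option linter.dupNamespace false

namespace Summit.NavierStokesRegularity.NavierStokesRegularity.Theorems.PoloidalWindowDoorPoloidalWindowRigidityHotSplitRidgeReductions

open Set Function MeasureTheory Filter Topology Metric
open scoped InnerProductSpace RealInnerProductSpace Laplacian
open Literature.Analysis Literature.Analysis.FluidPDE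
open Summit.NavierStokesRegularity.NavierStokesRegularity.Theorems.PoloidalWindowDoorPoloidalWindowRigidityWindow
open Summit.NavierStokesRegularity.NavierStokesRegularity.Theorems.PoloidalWindowDoorPoloidalWindowRigidityFirstIntegral
open Summit.NavierStokesRegularity.NavierStokesRegularity.Theorems.PoloidalWindowDoorPoloidalWindowRigidityLoopTangencyPin
open Summit.NavierStokesRegularity.NavierStokesRegularity.Theorems.PoloidalWindowDoorPoloidalWindowRigidityDiscDichotomy



/-- Smoothness package of the slice `v(−1)` in the pinned class (`Pinned` unfolded). [folklore] -/
theorem slice_facts {C : ℝ} {v : ℝ → EuclideanSpace ℝ (Fin 3) → EuclideanSpace ℝ (Fin 3)}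
    (hP : (Literature.Analysis.FluidPDE.HasTypeITimeDecay C v ∧
        ContinuousOn (Function.uncurry v) (Set.Iio (0 : ℝ) ×ˢ Set.univ) ∧
        (∀ s t : ℝ, s < t → t < 0 → ∀ x, v t x =
          Literature.Analysis.UnboundedOperators.heatExtension (v s) (t - s) x -
            Literature.Analysis.FluidPDE.oseenDuhamel 1 s v v t x) ∧
        (∀ t < 0, Literature.Analysis.FluidPDE.VectorCalculus.IsDivFree (v t)) ∧
        (∀ s < 0, ∀ y, ⟪Literature.Analysis.FluidPDE.curl (v s) y, EuclideanSpace.single 2 1⟫_ℝ = 0) ∧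
        v (-1) 0 2 ≠ 0 ∧ (∀ t < 0, ∀ x, Real.sqrt (-t) * |v t x 2| ≤ |v (-1) 0 2|) ∧
        (∀ h : EuclideanSpace ℝ (Fin 3), fderiv ℝ (v (-1)) 0 h 2 = 0) ∧
        (deriv (fun s => v s 0 2) (-1) = v (-1) 0 2 / 2 ∧ v (-1) 0 2 * (Δ (fun y => v (-1) y 2)) 0 ≤ 0))) :
    IsTypeIAncientMild C v ∧ ContDiff ℝ 2 (v (-1)) ∧ (∀ y, |v (-1) y 2| ≤ |v (-1) 0 2|) ∧
      (∀ y, curl (v (-1)) y 2 = 0) := by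
  obtain ⟨hrate, hcont, hmild, hdiv, hpol, _, hsup, -, -⟩ := hP
  have hA : IsTypeIAncientMild C v := isTypeIAncientMild_of_class hrate hcont hmild hdiv
  have hvs : ContDiff ℝ (⊤ : ℕ∞) (v (-1)) := hA.contDiff_slice (by norm_num)
  have hv2 : ContDiff ℝ 2 (v (-1)) := contDiff_infty.1 hvs 2
  refine ⟨hA, hv2, fun y => ?_, fun y => ?_⟩
  · have h := hsup (-1) (by norm_num) y
    simpa using h
  · have h := hpol (-1) (by norm_num) y
    simpa [EuclideanSpace.inner_single_right] using h

/-- **R1 `HotSetClosedCritical` (VERBATIM, `Pinned`/`hotSet` unfolded)** — the hot set is closed and critical: closedness by continuity of the slice, criticality by Fermat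
(`…LoopTangencyPin.fderiv_eq_zero_of_abs_le`). -/
theorem hotSetClosedCritical :
    ∀ (C : ℝ) (v : ℝ → EuclideanSpace ℝ (Fin 3) → EuclideanSpace ℝ (Fin 3)), (Literature.Analysis.FluidPDE.HasTypeITimeDecay C v ∧
        ContinuousOn (Function.uncurry v) (Set.Iio (0 : ℝ) ×ˢ Set.univ) ∧
        (∀ s t : ℝ, s < t → t < 0 → ∀ x, v t x =
          Literature.Analysis.UnboundedOperators.heatExtension (v s) (t - s) x -
            Literature.Analysis.FluidPDE.oseenDuhamel 1 s v v t x) ∧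
        (∀ t < 0, Literature.Analysis.FluidPDE.VectorCalculus.IsDivFree (v t)) ∧
        (∀ s < 0, ∀ y, ⟪Literature.Analysis.FluidPDE.curl (v s) y, EuclideanSpace.single 2 1⟫_ℝ = 0) ∧
        v (-1) 0 2 ≠ 0 ∧ (∀ t < 0, ∀ x, Real.sqrt (-t) * |v t x 2| ≤ |v (-1) 0 2|) ∧
        (∀ h : EuclideanSpace ℝ (Fin 3), fderiv ℝ (v (-1)) 0 h 2 = 0) ∧
        (deriv (fun s => v s 0 2) (-1) = v (-1) 0 2 / 2 ∧ v (-1) 0 2 * (Δ (fun y => v (-1) y 2)) 0 ≤ 0)) →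
    IsClosed {y : EuclideanSpace ℝ (Fin 3) | y 2 = 0 ∧ v (-1) y 2 = v (-1) 0 2} ∧ ∀ y ∈ {y : EuclideanSpace ℝ (Fin 3) | y 2 = 0 ∧ v (-1) y 2 = v (-1) 0 2}, fderiv ℝ (fun x => v (-1) x 2) y = 0 := by
  intro C v hP
  obtain ⟨hA, hv2, hext, -⟩ := slice_facts hP
  have hwcont : Continuous fun y => v (-1) y 2 := (contDiff_apply_coord_vec3 hv2 2).continuous
  have hcoord : Continuous fun y : EuclideanSpace ℝ (Fin 3) => y 2 := by
    simpa using (EuclideanSpace.proj (𝕜 := ℝ) (2 : Fin 3)).continuous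
  refine ⟨?_, ?_⟩
  · have h1 : IsClosed {y : EuclideanSpace ℝ (Fin 3) | y 2 = 0} := isClosed_eq hcoord continuous_const
    have h2 : IsClosed {y : EuclideanSpace ℝ (Fin 3) | v (-1) y 2 = v (-1) 0 2} :=
      isClosed_eq hwcont continuous_const
    have h12 := h1.inter h2
    have hset : {y : EuclideanSpace ℝ (Fin 3) | y 2 = 0 ∧ v (-1) y 2 = v (-1) 0 2} =
        {y : EuclideanSpace ℝ (Fin 3) | y 2 = 0} ∩ {y | v (-1) y 2 = v (-1) 0 2} := by
      ext y; simp
    rw [hset]; exact h12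
  · intro y hy
    have hle : ∀ z, |(fun x => v (-1) x 2) z| ≤ |(fun x => v (-1) x 2) y| := fun z => by
      simp only [hy.2]; exact hext z
    exact fderiv_eq_zero_of_abs_le hle

/-- **R2 `VortexLineHot` (VERBATIM, unfolded)** — the vortex line through a hot point is hot: Picard–Lindelöf for the `C¹` field `curl v(−1)` (Mathlib
`ContDiffAt.exists_forall_mem_closedBall_exists_eq_forall_mem_Ioo_hasDerivAt₀`), then `(γ τ)₂` and `v₂(−1, γ τ)` are first integrals
(`…LoopTangencyPin.apply_integralCurve_eq`; poloidality and the frozen law) — the template is the landed `…LoopTangencyPin.stub_loopTangencyPin`. -/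
theorem vortexLineHot :
    ∀ (C : ℝ) (v : ℝ → EuclideanSpace ℝ (Fin 3) → EuclideanSpace ℝ (Fin 3)), (Literature.Analysis.FluidPDE.HasTypeITimeDecay C v ∧
        ContinuousOn (Function.uncurry v) (Set.Iio (0 : ℝ) ×ˢ Set.univ) ∧
        (∀ s t : ℝ, s < t → t < 0 → ∀ x, v t x =
          Literature.Analysis.UnboundedOperators.heatExtension (v s) (t - s) x -
            Literature.Analysis.FluidPDE.oseenDuhamel 1 s v v t x) ∧
        (∀ t < 0, Literature.Analysis.FluidPDE.VectorCalculus.IsDivFree (v t)) ∧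
        (∀ s < 0, ∀ y, ⟪Literature.Analysis.FluidPDE.curl (v s) y, EuclideanSpace.single 2 1⟫_ℝ = 0) ∧
        v (-1) 0 2 ≠ 0 ∧ (∀ t < 0, ∀ x, Real.sqrt (-t) * |v t x 2| ≤ |v (-1) 0 2|) ∧
        (∀ h : EuclideanSpace ℝ (Fin 3), fderiv ℝ (v (-1)) 0 h 2 = 0) ∧
        (deriv (fun s => v s 0 2) (-1) = v (-1) 0 2 / 2 ∧ v (-1) 0 2 * (Δ (fun y => v (-1) y 2)) 0 ≤ 0)) →
    (∀ s < 0, ∀ y, ⟪fderiv ℝ (v s) y (Literature.Analysis.FluidPDE.curl (v s) y), EuclideanSpace.single 2 1⟫_ℝ = 0) →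
    ∀ y₀ ∈ {y : EuclideanSpace ℝ (Fin 3) | y 2 = 0 ∧ v (-1) y 2 = v (-1) 0 2}, ∃ (γ : ℝ → EuclideanSpace ℝ (Fin 3)) (ε : ℝ), 0 < ε ∧ γ 0 = y₀ ∧
      ∀ τ ∈ Set.Ioo (-ε) ε, HasDerivAt γ (Literature.Analysis.FluidPDE.curl (v (-1)) (γ τ)) τ ∧ γ τ ∈ {y : EuclideanSpace ℝ (Fin 3) | y 2 = 0 ∧ v (-1) y 2 = v (-1) 0 2} := by
  intro C v hP hFL y₀ hy₀
  obtain ⟨hA, hv2, hext, hpol1⟩ := slice_facts hP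
  have hω1 : ContDiff ℝ 1 (curl (v (-1))) := contDiff_curl (n := 1) (by exact_mod_cast hv2)
  have hvd : Differentiable ℝ (v (-1)) := hv2.differentiable two_ne_zero
  have hfrozen : ∀ y, fderiv ℝ (v (-1)) y (curl (v (-1)) y) 2 = 0 := fun y => by
    have h := hFL (-1) (by norm_num) y
    simpa [EuclideanSpace.inner_single_right] using h
  obtain ⟨c, hc0, ε, hε, hc⟩ :=
    (hω1.contDiffAt (x := y₀)).exists_forall_mem_closedBall_exists_eq_forall_mem_Ioo_hasDerivAt₀ 0
  have hc' : ∀ t ∈ Ioo (-ε) ε, HasDerivAt c (curl (v (-1)) (c t)) t := fun t ht =>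
    hc t (by simpa using ht)
  refine ⟨c, ε, hε, hc0, fun τ hτ => ⟨hc' τ hτ, ?_, ?_⟩⟩
  · -- the curve stays in the plane `{y₂ = 0}`
    have hφ : Differentiable ℝ (⇑(EuclideanSpace.proj (𝕜 := ℝ) (2 : Fin 3))) :=
      (EuclideanSpace.proj (𝕜 := ℝ) (2 : Fin 3)).differentiable
    have hφX : ∀ y, fderiv ℝ (⇑(EuclideanSpace.proj (𝕜 := ℝ) (2 : Fin 3))) y (curl (v (-1)) y) = 0 :=
      fun y => by
        rw [(EuclideanSpace.proj (𝕜 := ℝ) (2 : Fin 3)).fderiv]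
        simpa using hpol1 y
    have h := apply_integralCurve_eq hc' hφ hφX hτ
    rw [hc0] at h
    have h' : c τ 2 = y₀ 2 := by simpa using h
    rw [h']; exact hy₀.1
  · -- `v₂(−1,·)` is constant along the curve
    have hφ : Differentiable ℝ (fun y => v (-1) y 2) :=
      (contDiff_apply_coord_vec3 hv2 2).differentiable two_ne_zero
    have hφX : ∀ y, fderiv ℝ (fun y => v (-1) y 2) y (curl (v (-1)) y) = 0 := fun y => by
      rw [fderiv_apply_coord_vec3 (hvd y) 2]
      exact hfrozen y
    have h := apply_integralCurve_eq hc' hφ hφX hτ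
    rw [hc0] at h
    rw [h]; exact hy₀.2

/-- **R3 `NoCompactIsolatedHotPiece` (VERBATIM, unfolded)** — no compact isolated hot piece: `Peakless` at `(−1, 0, σ, |N|)` with `σN = |N|`. -/
theorem noCompactIsolatedHotPiece :
    ∀ (C : ℝ) (v : ℝ → EuclideanSpace ℝ (Fin 3) → EuclideanSpace ℝ (Fin 3)), (Literature.Analysis.FluidPDE.HasTypeITimeDecay C v ∧
        ContinuousOn (Function.uncurry v) (Set.Iio (0 : ℝ) ×ˢ Set.univ) ∧
        (∀ s t : ℝ, s < t → t < 0 → ∀ x, v t x =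
          Literature.Analysis.UnboundedOperators.heatExtension (v s) (t - s) x -
            Literature.Analysis.FluidPDE.oseenDuhamel 1 s v v t x) ∧
        (∀ t < 0, Literature.Analysis.FluidPDE.VectorCalculus.IsDivFree (v t)) ∧
        (∀ s < 0, ∀ y, ⟪Literature.Analysis.FluidPDE.curl (v s) y, EuclideanSpace.single 2 1⟫_ℝ = 0) ∧
        v (-1) 0 2 ≠ 0 ∧ (∀ t < 0, ∀ x, Real.sqrt (-t) * |v t x 2| ≤ |v (-1) 0 2|) ∧
        (∀ h : EuclideanSpace ℝ (Fin 3), fderiv ℝ (v (-1)) 0 h 2 = 0) ∧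
        (deriv (fun s => v s 0 2) (-1) = v (-1) 0 2 / 2 ∧ v (-1) 0 2 * (Δ (fun y => v (-1) y 2)) 0 ≤ 0)) → (∀ (s z₀ σ M : ℝ) (K O : Set (EuclideanSpace ℝ (Fin 3))), s < 0 →
        ((σ = 1 ∨ σ = -1) ∧ IsCompact K ∧ K.Nonempty ∧ (∀ y ∈ K, y 2 = z₀ ∧ σ * v s y 2 = M) ∧
          IsOpen O ∧ K ⊆ O ∧ (∀ y ∈ O, y 2 = z₀ → σ * v s y 2 ≤ M) ∧
          (∀ y ∈ O, y 2 = z₀ → σ * v s y 2 = M → y ∈ K)) → False) →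
    ∀ K O : Set (EuclideanSpace ℝ (Fin 3)), IsCompact K → K.Nonempty → K ⊆ {y : EuclideanSpace ℝ (Fin 3) | y 2 = 0 ∧ v (-1) y 2 = v (-1) 0 2} → IsOpen O → K ⊆ O →
      O ∩ {y : EuclideanSpace ℝ (Fin 3) | y 2 = 0 ∧ v (-1) y 2 = v (-1) 0 2} ⊆ K → False := by
  intro C v hP hPk K O hK hKne hKH hO hKO hOH
  obtain ⟨-, -, hext, -⟩ := slice_facts hP
  obtain ⟨-, -, -, -, -, hN, -, -, -⟩ := hP
  set N := v (-1) 0 2 with hNdef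
  -- the sign `σ` with `σ N = |N|`
  obtain ⟨σ, hσ1, hσN⟩ : ∃ σ : ℝ, (σ = 1 ∨ σ = -1) ∧ σ * N = |N| := by
    rcases le_or_gt 0 N with h | h
    · exact ⟨1, Or.inl rfl, by rw [one_mul, abs_of_nonneg h]⟩
    · exact ⟨-1, Or.inr rfl, by rw [abs_of_neg h]; ring⟩
  have hσne : σ ≠ 0 := by rcases hσ1 with h | h <;> simp [h]
  have hσabs : ∀ a : ℝ, σ * a ≤ |a| := fun a => by
    rcases hσ1 with h | h
    · rw [h, one_mul]; exact le_abs_self a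
    · rw [h, neg_one_mul]; exact neg_le_abs a
  apply hPk (-1) 0 σ |N| K O (by norm_num)
  refine ⟨hσ1, hK, hKne, ?_, hO, hKO, ?_, ?_⟩
  · intro y hy
    obtain ⟨hy0, hyN⟩ := hKH hy
    exact ⟨hy0, by rw [hyN, hσN]⟩
  · intro y _ _
    exact (hσabs _).trans (hext y)
  · intro y hyO hy0 hyM
    apply hOH
    refine ⟨hyO, hy0, ?_⟩
    have h : σ * v (-1) y 2 = σ * N := by rw [hyM, hσN]
    exact mul_left_cancel₀ hσne h

/-- **R4 `HotSetNoInterior` (VERBATIM, unfolded)** — the hot set is nowhere dense in `P₀`: the planar identity theorem `…DiscDichotomy.eq_const_on_plane_of_analytic` on the disc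
`ball y r ∩ P₀`, analyticity from `IsTypeIAncientMild.analyticOnNhd_slice_univ`. -/
theorem hotSetNoInterior :
    ∀ (C : ℝ) (v : ℝ → EuclideanSpace ℝ (Fin 3) → EuclideanSpace ℝ (Fin 3)), (Literature.Analysis.FluidPDE.HasTypeITimeDecay C v ∧
        ContinuousOn (Function.uncurry v) (Set.Iio (0 : ℝ) ×ˢ Set.univ) ∧
        (∀ s t : ℝ, s < t → t < 0 → ∀ x, v t x =
          Literature.Analysis.UnboundedOperators.heatExtension (v s) (t - s) x -
            Literature.Analysis.FluidPDE.oseenDuhamel 1 s v v t x) ∧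
        (∀ t < 0, Literature.Analysis.FluidPDE.VectorCalculus.IsDivFree (v t)) ∧
        (∀ s < 0, ∀ y, ⟪Literature.Analysis.FluidPDE.curl (v s) y, EuclideanSpace.single 2 1⟫_ℝ = 0) ∧
        v (-1) 0 2 ≠ 0 ∧ (∀ t < 0, ∀ x, Real.sqrt (-t) * |v t x 2| ≤ |v (-1) 0 2|) ∧
        (∀ h : EuclideanSpace ℝ (Fin 3), fderiv ℝ (v (-1)) 0 h 2 = 0) ∧
        (deriv (fun s => v s 0 2) (-1) = v (-1) 0 2 / 2 ∧ v (-1) 0 2 * (Δ (fun y => v (-1) y 2)) 0 ≤ 0)) →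
    (∃ y : EuclideanSpace ℝ (Fin 3), y 2 = 0 ∧ v (-1) y 2 ≠ v (-1) 0 2) →
    ∀ y ∈ {y : EuclideanSpace ℝ (Fin 3) | y 2 = 0 ∧ v (-1) y 2 = v (-1) 0 2}, ∀ r : ℝ, 0 < r →
      ∃ y' : EuclideanSpace ℝ (Fin 3), y' 2 = 0 ∧ dist y' y < r ∧ v (-1) y' 2 ≠ v (-1) 0 2 := by
  intro C v hP hnon y hy r hr
  obtain ⟨hA, hv2, -, -⟩ := slice_facts hP
  have hwan : AnalyticOnNhd ℝ (fun y => v (-1) y 2) univ := fun y _ =>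
    ((EuclideanSpace.proj (𝕜 := ℝ) (2 : Fin 3)).analyticAt _).comp
      (hA.analyticOnNhd_slice_univ (by norm_num) y (mem_univ _))
  by_contra hcon
  push Not at hcon
  -- `v₂(−1,·) = N` on the planar disc `ball y r ∩ P₀`
  have hc : ∀ y' ∈ ball y r, y' 2 = 0 → v (-1) y' 2 = v (-1) 0 2 := fun y' hy' hy'0 =>
    hcon y' hy'0 (mem_ball.1 hy')
  have hall := eq_const_on_plane_of_analytic hwan isOpen_ball ⟨y, mem_ball_self hr, hy.1⟩ hc
  obtain ⟨y₁, hy₁0, hy₁N⟩ := hnon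
  exact hy₁N (hall y₁ hy₁0)

end Summit.NavierStokesRegularity.NavierStokesRegularity.Theorems.PoloidalWindowDoorPoloidalWindowRigidityHotSplitRidgeReductions

end
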